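import Summits.Ventures.Crystal3D.Theorems.StickyWulffConstantPolycrystalWulffBoundBlockRows
import Summits.Ventures.Crystal3D.Theorems.StickyWulffConstantPolycrystalWulffBoundBlockIso

/-!
# `PolycrystalWulffBound`, line `PolyDensity`: LP rows in CLASS variables (bridge, part 1)

Route `StickyWulffConstant` of the venture `Summits/Ventures/Crystal3D`, crux `PolycrystalWulffBound`
(item `stmt-Ventures-19482`), second prover lane (poly-p2, gen 4).  The typed certificate `cert3_k278`
(`…Cert3Assembly`) speaks about CLASS variables: for a labelling `cls : Fin n → β` of the grains and
class bodies `KC : β → Set E3` (the body of grain `f` is `KC (cls f)`), the class free energies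
`F i = Σ_{cls f = i} Fr_f`, free areas `Y i`, class-pair interfaces `Acl i j = Σ_{cls f = i, cls g = j} w f g`
and class volumes.  This file turns the per-block rows of `…BlockRows` / `…BlockIso` into rows over a
SET OF CLASSES `S`:

* `classBlock_row` — `3·Kq^{1/3}·|E_S|^{2/3} ≤ Σ_{i∈S} F i + ρq·Σ_{i∈S} Σ_{j∉S} Acl i j` for any body
  `KB ⊆ KC i (i ∈ S)` with `Kq ≤ |KB|`, `KB ⊆ B̄(0,ρ)`, `ρ ≤ ρq` (rows block/shv of the certificate);
* `classFloor_row` — `rq·Y i ≤ F i` for `B̄(0,r) ⊆ KC i`, `rq ≤ r`;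
* `classIso_row` — `3(4π/3)^{1/3}|E_i|^{2/3} ≤ Y i + Σ_{j ≠ i} Acl i j`;
* `classVolume_sum` — `|E_S| = Σ_{i∈S} |E_i|`, and `freeArea_grain_nonneg`-type facts for the classes.
WHAT THIS IS NOT: the wall and recolouring rows (crux vocabulary, `…WallRow`, `recolour_move`); F-C1 not moved.
-/

noncomputable section

namespace Summit.Ventures.Crystal3D.Theorems

open MeasureTheory Set Metric
open scoped RealInnerProductSpace ENNReal Pointwise
open Summit.Ventures.Crystal3D.Cruxes.TextureLiminf.TexShadow
open Literature.Analysis.Convexity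
open Literature.MathematicalPhysics.StatisticalMechanics (perimeter HasFinitePerimeter)

variable {n : ℕ} {β : Type} [DecidableEq β]

/-- Class-pair interfaces: the block sum `Σ_{f ∈ S-grains} Σ_{g ∉ S-grains} w f g` equals
`Σ_{i∈S} Σ_{j∉S} Acl i j` (fibrewise in both variables). -/
theorem classPair_sum [Fintype β] (cls : Fin n → β) (w : Fin n → Fin n → ℝ) (S : Finset β) :
    (∑ f ∈ Finset.univ.filter (fun f => cls f ∈ S), ∑ g ∈ Finset.univ \ Finset.univ.filter (fun f => cls f ∈ S),
        w f g) =
      ∑ i ∈ S, ∑ j ∈ Finset.univ \ S, ∑ f ∈ Finset.univ.filter (fun f => cls f = i),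
        ∑ g ∈ Finset.univ.filter (fun g => cls g = j), w f g := by
  classical
  -- outer fibrewise decomposition
  have hout : ∀ (φ : Fin n → ℝ), (∑ f ∈ Finset.univ.filter (fun f => cls f ∈ S), φ f) =
      ∑ i ∈ S, ∑ f ∈ Finset.univ.filter (fun f => cls f = i), φ f := by
    intro φ
    rw [← Finset.sum_fiberwise_of_maps_to (g := cls) (t := S) (fun f hf => (Finset.mem_filter.1 hf).2)]
    refine Finset.sum_congr rfl fun i hi => Finset.sum_congr ?_ fun _ _ => rfl
    ext f; simp only [Finset.mem_filter, Finset.mem_univ, true_and]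
    exact ⟨fun h => h.2, fun h => ⟨h ▸ hi, h⟩⟩
  have hcompl : Finset.univ \ Finset.univ.filter (fun f => cls f ∈ S) =
      Finset.univ.filter (fun f => cls f ∈ Finset.univ \ S) := by
    ext f; simp [Finset.mem_sdiff]
  have hin : ∀ (ψ : Fin n → ℝ), (∑ g ∈ Finset.univ \ Finset.univ.filter (fun f => cls f ∈ S), ψ g) =
      ∑ j ∈ Finset.univ \ S, ∑ g ∈ Finset.univ.filter (fun g => cls g = j), ψ g := by
    intro ψ
    rw [hcompl, ← Finset.sum_fiberwise_of_maps_to (g := cls) (t := Finset.univ \ S)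
      (fun f hf => (Finset.mem_filter.1 hf).2)]
    refine Finset.sum_congr rfl fun j hj => Finset.sum_congr ?_ fun _ _ => rfl
    ext f; simp only [Finset.mem_filter, Finset.mem_univ, true_and]
    exact ⟨fun h => h.2, fun h => ⟨h ▸ hj, h⟩⟩
  rw [hout]
  refine Finset.sum_congr rfl fun i _ => ?_
  rw [Finset.sum_comm, hin (fun g => ∑ f ∈ Finset.univ.filter (fun f => cls f = i), w f g)]
  exact Finset.sum_congr rfl fun j _ => Finset.sum_comm

/-- Class volumes add up over a set of classes: `|⋃_{cls f ∈ S} G f| = Σ_{i∈S} |⋃_{cls f = i} G f|`. -/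
theorem classVolume_sum [Fintype β] (G : Fin n → Set E3)
    (hfin : ∀ f, HasFinitePerimeter (G f) ∧ volume (G f) < ⊤)
    (hdisjG : ∀ f g, f ≠ g → Disjoint (G f) (G g)) (cls : Fin n → β) (S : Finset β) :
    (volume (⋃ f ∈ Finset.univ.filter (fun f => cls f ∈ S), G f)).toReal =
      ∑ i ∈ S, (volume (⋃ f ∈ Finset.univ.filter (fun f => cls f = i), G f)).toReal := by
  classical
  rw [(subfamily_union_facts G hfin hdisjG _).2.2.2]
  rw [← Finset.sum_fiberwise_of_maps_to (g := cls) (t := S) (fun f hf => (Finset.mem_filter.1 hf).2)]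
  refine Finset.sum_congr rfl fun i hi => ?_
  rw [(subfamily_union_facts G hfin hdisjG _).2.2.2]
  refine Finset.sum_congr ?_ fun _ _ => rfl
  ext f; simp only [Finset.mem_filter, Finset.mem_univ, true_and]
  exact ⟨fun h => h.2, fun h => ⟨h ▸ hi, h⟩⟩

/-- **Row «block/shv» over a set of classes `S`.**  Body `KB` inside every class body of `S`, with
`Kq ≤ |KB|` and `KB ⊆ B̄(0,ρ)`, `ρ ≤ ρq`:
`3·Kq^{1/3}·|E_S|^{2/3} ≤ Σ_{i∈S} F i + ρq·Σ_{i∈S}Σ_{j∉S} Acl i j`. -/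
theorem classBlock_row [Fintype β] (G : Fin n → Set E3)
    (hfin : ∀ f, HasFinitePerimeter (G f) ∧ volume (G f) < ⊤)
    (hPoly : ∀ f, ∃ (k : ℕ) (H : Fin k → Finset (E3 × ℝ)), G f = ⋃ i, polytope (H i))
    (hdisjG : ∀ f g, f ≠ g → Disjoint (G f) (G g)) (cls : Fin n → β) (KC : β → Set E3)
    (hKc : ∀ i, IsCompact (KC i)) (hKv : ∀ i, Convex ℝ (KC i)) (hK0 : ∀ i, (0 : E3) ∈ KC i)
    (hKs : ∀ i, -KC i = KC i) (S : Finset β) (KB : Set E3) (hBc : IsCompact KB) (hBv : Convex ℝ KB)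
    (hB0 : (0 : E3) ∈ KB) (hBs : -KB = KB) {ρ ρq Kq : ℝ} (hρ : 0 < ρ) (hρq : ρ ≤ ρq)
    (hBR : KB ⊆ closedBall (0 : E3) ρ) (hKq0 : 0 ≤ Kq) (hKq : Kq ≤ (volume KB).toReal)
    (hsub : ∀ i ∈ S, KB ⊆ KC i) :
    3 * Kq ^ ((1 : ℝ) / 3) *
        (volume (⋃ f ∈ Finset.univ.filter (fun f => cls f ∈ S), G f)).toReal ^ ((2 : ℝ) / 3) ≤
      (∑ i ∈ S, ∑ f ∈ Finset.univ.filter (fun f => cls f = i),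
        (per (KC (cls f)) (G f) - ∑ g, (if f = g then 0 else
          (per (KC (cls f)) (G f) + per (KC (cls f)) (G g) - per (KC (cls f)) (G f ∪ G g)) / 2))) +
      ρq * ∑ i ∈ S, ∑ j ∈ Finset.univ \ S, ∑ f ∈ Finset.univ.filter (fun f => cls f = i),
        ∑ g ∈ Finset.univ.filter (fun g => cls g = j),
          (per (closedBall (0 : E3) 1) (G f) + per (closedBall (0 : E3) 1) (G g) -
            per (closedBall (0 : E3) 1) (G f ∪ G g)) / 2 := by
  classical
  have hvol : ∀ f, volume (G f) < ⊤ := fun f => (hfin f).2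
  set B : Finset (Fin n) := Finset.univ.filter (fun f => cls f ∈ S) with hB
  have hblock := block_wulff_le_blockFreeEnergy G hfin hPoly hdisjG (fun f => KC (cls f))
    (fun f => hKc _) (fun f => hKv _) (fun f => hK0 _) (fun f => hKs _) B KB hBc hBv hB0 hBs hρ hBR
    (fun f hf => hsub (cls f) (Finset.mem_filter.1 hf).2)
  -- the block free energy, fibrewise
  have hF : (∑ f ∈ B, (per (KC (cls f)) (G f) - ∑ g, (if f = g then 0 else
      (per (KC (cls f)) (G f) + per (KC (cls f)) (G g) - per (KC (cls f)) (G f ∪ G g)) / 2))) =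
      ∑ i ∈ S, ∑ f ∈ Finset.univ.filter (fun f => cls f = i),
        (per (KC (cls f)) (G f) - ∑ g, (if f = g then 0 else
          (per (KC (cls f)) (G f) + per (KC (cls f)) (G g) - per (KC (cls f)) (G f ∪ G g)) / 2)) := by
    rw [← Finset.sum_fiberwise_of_maps_to (g := cls) (t := S) (fun f hf => (Finset.mem_filter.1 hf).2)]
    refine Finset.sum_congr rfl fun i hi => Finset.sum_congr ?_ fun _ _ => rfl
    ext f; simp only [Finset.mem_filter, Finset.mem_univ, true_and]
    exact ⟨fun h => h.2, fun h => ⟨h ▸ hi, h⟩⟩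
  have hA := classPair_sum cls (fun f g => (per (closedBall (0 : E3) 1) (G f) +
    per (closedBall (0 : E3) 1) (G g) - per (closedBall (0 : E3) 1) (G f ∪ G g)) / 2) S
  rw [hF] at hblock
  simp only [← hB] at hA
  rw [hA] at hblock
  -- nonnegativity of the interface sum
  have hwnn : ∀ f g, 0 ≤ (per (closedBall (0 : E3) 1) (G f) + per (closedBall (0 : E3) 1) (G g) -
      per (closedBall (0 : E3) 1) (G f ∪ G g)) / 2 := by
    intro f g
    by_cases hfg : f = g
    · subst hfg
      have hp : 0 ≤ per (closedBall (0 : E3) 1) (G f) := by unfold per; exact ENNReal.toReal_nonneg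
      rw [Set.union_self]; linarith
    · exact div_nonneg (iota_nonneg_of_poly G hPoly hvol hdisjG (isCompact_closedBall (0 : E3) 1)
        (convex_closedBall 0 1) (mem_closedBall_self zero_le_one) hfg) zero_le_two
  have hAnn : 0 ≤ ∑ i ∈ S, ∑ j ∈ Finset.univ \ S, ∑ f ∈ Finset.univ.filter (fun f => cls f = i),
      ∑ g ∈ Finset.univ.filter (fun g => cls g = j),
        (per (closedBall (0 : E3) 1) (G f) + per (closedBall (0 : E3) 1) (G g) -
          per (closedBall (0 : E3) 1) (G f ∪ G g)) / 2 :=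
    Finset.sum_nonneg fun _ _ => Finset.sum_nonneg fun _ _ => Finset.sum_nonneg fun _ _ =>
      Finset.sum_nonneg fun _ _ => hwnn _ _
  -- weaken the constants
  have hvolnn : 0 ≤ (volume (⋃ f ∈ B, G f)).toReal ^ ((2 : ℝ) / 3) := by positivity
  have hK3 : Kq ^ ((1 : ℝ) / 3) ≤ (volume KB).toReal ^ ((1 : ℝ) / 3) :=
    Real.rpow_le_rpow hKq0 hKq (by norm_num)
  have h1 : 3 * Kq ^ ((1 : ℝ) / 3) * (volume (⋃ f ∈ B, G f)).toReal ^ ((2 : ℝ) / 3) ≤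
      3 * (volume KB).toReal ^ ((1 : ℝ) / 3) * (volume (⋃ f ∈ B, G f)).toReal ^ ((2 : ℝ) / 3) := by
    gcongr
  have h2 := mul_le_mul_of_nonneg_right hρq hAnn
  linarith

/-- **Row «floor» for one class**: `rq · Y i ≤ F i` when `B̄(0,r) ⊆ KC i` and `rq ≤ r`. -/
theorem classFloor_row (G : Fin n → Set E3)
    (hPoly : ∀ f, ∃ (k : ℕ) (H : Fin k → Finset (E3 × ℝ)), G f = ⋃ i, polytope (H i))
    (hvol : ∀ f, volume (G f) < ⊤) (hdisjG : ∀ f g, f ≠ g → Disjoint (G f) (G g))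
    (cls : Fin n → β) (KC : β → Set E3)
    (hKc : ∀ i, IsCompact (KC i)) (hKv : ∀ i, Convex ℝ (KC i)) (hK0 : ∀ i, (0 : E3) ∈ KC i)
    (hKs : ∀ i, -KC i = KC i) {r rq : ℝ} (hr : 0 < r) (hrq : rq ≤ r) (i : β)
    (hball : closedBall (0 : E3) r ⊆ KC i) :
    rq * (∑ f ∈ Finset.univ.filter (fun f => cls f = i), (per (closedBall (0 : E3) 1) (G f) -
        ∑ g, (if f = g then 0 else (per (closedBall (0 : E3) 1) (G f) + per (closedBall (0 : E3) 1) (G g) -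
          per (closedBall (0 : E3) 1) (G f ∪ G g)) / 2))) ≤
      ∑ f ∈ Finset.univ.filter (fun f => cls f = i), (per (KC (cls f)) (G f) - ∑ g, (if f = g then 0 else
        (per (KC (cls f)) (G f) + per (KC (cls f)) (G g) - per (KC (cls f)) (G f ∪ G g)) / 2)) := by
  have h := floor_le_blockFreeEnergy G hPoly hvol hdisjG (fun f => KC (cls f)) (fun f => hKc _)
    (fun f => hKv _) (fun f => hK0 _) (fun f => hKs _) hr (Finset.univ.filter (fun f => cls f = i))
    (fun f hf => by rw [(Finset.mem_filter.1 hf).2]; exact hball)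
  have hYnn : 0 ≤ ∑ f ∈ Finset.univ.filter (fun f => cls f = i), (per (closedBall (0 : E3) 1) (G f) -
      ∑ g, (if f = g then 0 else (per (closedBall (0 : E3) 1) (G f) + per (closedBall (0 : E3) 1) (G g) -
        per (closedBall (0 : E3) 1) (G f ∪ G g)) / 2)) :=
    Finset.sum_nonneg fun f _ => freeArea_nonneg G hPoly hvol hdisjG f
  have := mul_le_mul_of_nonneg_right hrq hYnn
  linarith

/-- **Row «iso» for one class** in class variables: `3(4π/3)^{1/3}|E_i|^{2/3} ≤ Y i + Σ_{j≠i} Acl i j`. -/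
theorem classIso_row [Fintype β] (G : Fin n → Set E3)
    (hfin : ∀ f, HasFinitePerimeter (G f) ∧ volume (G f) < ⊤)
    (hPoly : ∀ f, ∃ (k : ℕ) (H : Fin k → Finset (E3 × ℝ)), G f = ⋃ i, polytope (H i))
    (hdisjG : ∀ f g, f ≠ g → Disjoint (G f) (G g)) (cls : Fin n → β) (i : β) :
    3 * (Real.pi * 4 / 3) ^ ((1 : ℝ) / 3) *
        (volume (⋃ f ∈ Finset.univ.filter (fun f => cls f = i), G f)).toReal ^ ((2 : ℝ) / 3) ≤
      (∑ f ∈ Finset.univ.filter (fun f => cls f = i), (per (closedBall (0 : E3) 1) (G f) -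
        ∑ g, (if f = g then 0 else (per (closedBall (0 : E3) 1) (G f) + per (closedBall (0 : E3) 1) (G g) -
          per (closedBall (0 : E3) 1) (G f ∪ G g)) / 2))) +
      ∑ j ∈ Finset.univ \ {i}, ∑ f ∈ Finset.univ.filter (fun f => cls f = i),
        ∑ g ∈ Finset.univ.filter (fun g => cls g = j),
          (per (closedBall (0 : E3) 1) (G f) + per (closedBall (0 : E3) 1) (G g) -
            per (closedBall (0 : E3) 1) (G f ∪ G g)) / 2 := by
  classical
  have h := iso_le_block G hfin hPoly hdisjG (Finset.univ.filter (fun f => cls f = i))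
  have hA := classPair_sum cls (fun f g => (per (closedBall (0 : E3) 1) (G f) +
    per (closedBall (0 : E3) 1) (G g) - per (closedBall (0 : E3) 1) (G f ∪ G g)) / 2) {i}
  have hset : Finset.univ.filter (fun f => cls f ∈ ({i} : Finset β)) =
      Finset.univ.filter (fun f => cls f = i) := by
    ext f; simp
  rw [hset] at hA
  rw [hA, Finset.sum_singleton] at h
  exact h

end Summit.Ventures.Crystal3D.Theorems

end
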